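import Mathlib

/-!
# SoloBlind kernel #104 — the live-cubic turning points of the kink-contact corner

Solo-blind programme `AnomalousDissipation`, steady door, paper §24.54 (s56).
At the upstream (kink) contact of the designed steady family the live slow trajectory of the
normalised level-B system is the cubic `u₀(ξ) = ξ + ξ²/2 + ξ³/6` (from `u''' = 1`, `u = u' = u'' = 0`
at the contact).  §24.54 shows — with pre-registered, parameter-free predictions P82-2/3 — that the
late terms of the COUPLED slow–fast corner hierarchy are governed by the action
`S_c = ∫₀^{z₁} √(2 u₀(t)) dt` to the complex turning points `z₁` of `u₀`, i.e. the non-zero roots of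
`u₀`, which are the roots of `z² + 3 z + 6`: `z₁ = (-3 ± i√15)/2`, `|z₁| = √6`
(`|S_c| = 2.3596` predicted, `2.3622` measured; `arg` to `10⁻⁴ π`).  On the real line `u₀` vanishes
only at the contact itself (`x² + 3x + 6 > 0`), which is why the governing turning points are complex
and the corner series is sign-oscillating with period `≈ 8/3`.  This file certifies the algebra of the
turning points; the quadrature of `S_c` and the numerics are in HOME/work/coupled (CLAIMS SB-C595).
It also records the elementary identity behind the closed form of the dead-sheet cycle action for a
quadratic pinning function, `π(√(M+1) - 1)²/√M` (§24.54(3), SB-C596).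
-/

namespace Summit.AnomalousDissipation.AnomalousDissipation.Theorems

open Complex

/-- The live-cubic turning point of the kink contact: `z₁ = (-3 + i√15)/2`. -/
noncomputable def liveCubicTurningPoint : ℂ := (-3 + (Real.sqrt 15 : ℂ) * I) / 2

/-- `(√15)² = 15` as complex numbers. -/
theorem sqrt15_sq : ((Real.sqrt 15 : ℂ)) ^ 2 = 15 := by
  have h : (Real.sqrt 15) ^ 2 = 15 := Real.sq_sqrt (by norm_num)
  exact_mod_cast h

/-- `z₁` is a root of `z² + 3z + 6`. -/
theorem liveCubicTurningPoint_quadratic :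
    liveCubicTurningPoint ^ 2 + 3 * liveCubicTurningPoint + 6 = 0 := by
  unfold liveCubicTurningPoint
  linear_combination (I ^ 2 / 4) * sqrt15_sq + (15 / 4 : ℂ) * I_sq

/-- `z₁` is a (non-zero) root of the live cubic `u₀(z) = z + z²/2 + z³/6`. -/
theorem liveCubicTurningPoint_root :
    liveCubicTurningPoint + liveCubicTurningPoint ^ 2 / 2 + liveCubicTurningPoint ^ 3 / 6 = 0 := by
  have h := liveCubicTurningPoint_quadratic
  have : liveCubicTurningPoint + liveCubicTurningPoint ^ 2 / 2 + liveCubicTurningPoint ^ 3 / 6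
      = liveCubicTurningPoint / 6 * (liveCubicTurningPoint ^ 2 + 3 * liveCubicTurningPoint + 6) := by
    ring
  rw [this, h, mul_zero]

/-- The conjugate turning point `z̄₁ = (-3 - i√15)/2` is the other root of `z² + 3z + 6`. -/
theorem liveCubicTurningPoint_conj_quadratic :
    (starRingEnd ℂ liveCubicTurningPoint) ^ 2 + 3 * starRingEnd ℂ liveCubicTurningPoint + 6 = 0 := by
  have h := congrArg (starRingEnd ℂ) liveCubicTurningPoint_quadratic
  simpa [map_add, map_mul, map_pow, map_ofNat] using h

/-- `|z₁|² = 6`, i.e. the turning points lie at distance `√6` from the contact. -/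
theorem liveCubicTurningPoint_normSq : Complex.normSq liveCubicTurningPoint = 6 := by
  unfold liveCubicTurningPoint
  rw [Complex.normSq_apply]
  simp [Complex.add_re, Complex.add_im, Complex.mul_re, Complex.mul_im,
    Complex.ofReal_re, Complex.ofReal_im, Complex.I_re, Complex.I_im]
  have h : Real.sqrt 15 * Real.sqrt 15 = 15 := Real.mul_self_sqrt (by norm_num)
  nlinarith [h]

/-- On the real line the live cubic vanishes only at the contact: `x² + 3x + 6 > 0`. -/
theorem liveCubic_cofactor_pos (x : ℝ) : 0 < x ^ 2 + 3 * x + 6 := by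
  nlinarith [sq_nonneg (x + 3 / 2)]

/-- Hence `u₀(x) = x + x²/2 + x³/6 = 0` for real `x` iff `x = 0`: the governing turning points of the
kink-contact corner are the complex pair `z₁, z̄₁`. -/
theorem liveCubic_real_root_iff (x : ℝ) : x + x ^ 2 / 2 + x ^ 3 / 6 = 0 ↔ x = 0 := by
  constructor
  · intro h
    have hf : x / 6 * (x ^ 2 + 3 * x + 6) = 0 := by
      have : x / 6 * (x ^ 2 + 3 * x + 6) = x + x ^ 2 / 2 + x ^ 3 / 6 := by ring
      rw [this, h]
    rcases mul_eq_zero.mp hf with h1 | h2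
    · linarith
    · exact absurd h2 (ne_of_gt (liveCubic_cofactor_pos x))
  · intro h
    subst h
    norm_num

/-- The algebra behind the closed form of the dead-sheet cycle action for a quadratic pinning
function `G(m) = m(1 - m/M)` (§24.54(3)): `M + 2 - 2√(M+1) = (√(M+1) - 1)²` for `M ≥ -1`, so that
`π(M/2 + 1 - √(M+1)) = (π/2)(√(M+1) - 1)²`. -/
theorem deadCycle_closed_form_alg {M : ℝ} (hM : -1 ≤ M) :
    M + 2 - 2 * Real.sqrt (M + 1) = (Real.sqrt (M + 1) - 1) ^ 2 := by
  have h : Real.sqrt (M + 1) ^ 2 = M + 1 := Real.sq_sqrt (by linarith)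
  nlinarith [h]

end Summit.AnomalousDissipation.AnomalousDissipation.Theorems
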